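import Summits.CriticalPhenomena.PercolationContinuityZ3.Theorems.PercLowPointHalfSpaceTallClusterMassBoundOnesidedHalvesTypicalMaxGrowthForms
import Summits.CriticalPhenomena.PercolationContinuityZ3.Theorems.PercLowPointHalfSpaceTallClusterMassBoundOnesidedHalvesLateralInvariance
import Literature.Barriers.CriticalPhenomena.KozmaNachmiasLemma23B3

/-!
# `TallClusterMassBound` (stmt-CriticalPhenomena-0912), line `onesided-halves` — stub G ⟸ cluster-count tightness

Stub G (`stub_typicalMaxPolyGrowth`: `∃ c κ > 0, ∀ 1 ≤ ρ ≤ r, c (r/ρ)^κ M(Λ_ρ) ≤ M(Λ_r)`, `M(Λ) = typicalMax P^ℍ Λ`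
Hutchcroft's typical maximum under the induced half-space percolation `P^ℍ = floorDilutedPercolation 3 p_c 1` at
`p_c(ℤ³)`, `Λ_r = halfBox r`) is hyperscaling-class. This file kernel-checks the reduction of G to a
Borgs–Chayes–Kesten–Spencer-type CLUSTER-COUNT TIGHTNESS postulate on the half-space (BCKS 1999: under uniform
crossing bounds the number of clusters of size `≥ ε M` in a box is tight), registered helper
`typicalMaxPolyGrowth_of_tightClusterCount`:

  if for SOME `K` and all `R ≥ 1`, `P^ℍ(∃ K pairwise non-connected vertices of Λ_R, each with ≥ M(Λ_R)/128 cluster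
  vertices in Λ_R) ≤ 1/4`, then G.

Proof (the dichotomy of the line's notes, all ingredients landed): by `typicalMaxPolyGrowth_iff_fixedRatio` it suffices
to double `M` at one fixed ratio `L = 3A+1`, `A = 20K+1`. If `M(Λ_{Lr}) < 2M(Λ_r)` then, among the `(2A+1)²` disjoint
LATERAL translates of `Λ_r` in `Λ_{Lr}` (§2), fewer than half fail to carry a cluster of local trace `≥ M(Λ_r)/64` off
an event of probability `≤ 1/4` (two-sided tightness `real_clusterMaxIn_halfBox_translate_lt_le` + Markov for the
count, §3); no cluster has `≥ 3M(Λ_{Lr})` vertices in `Λ_{Lr}` off an event of probability `≤ e^{-2}` (upper tail);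
so by superadditivity of cluster traces over disjoint sub-boxes one cluster serves `< 384` good translates and a
maximal pairwise non-connected family of near-maximisers has `> (2A+1)²/768 ≥ K` members (§1), each of trace
`≥ M(Λ_r)/64 > M(Λ_{Lr})/128` — the hypothesis' event at `R = Lr` would have probability `≥ 3/4 - e^{-2} > 1/4`.

Nothing here asserts G or the postulate; no Theses statement is touched; no definitions.
-/

noncomputable section

open MeasureTheory Finset Filter
open Literature.Probability.Percolation Literature.Probability.LatticeModels
open Summit.CriticalPhenomena.PercolationContinuityZ3.Theorems.TallClusterMassBound.Negative
open Summit.CriticalPhenomena.PercolationContinuityZ3.Theorems.TallClusterMassBound.TightnessLine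
open Summit.CriticalPhenomena.PercolationContinuityZ3.Theorems.FloorRusso.Reduce (clusterCapIn_mono_set)

namespace Summit.CriticalPhenomena.PercolationContinuityZ3.Theorems.TallClusterMassBound.OnesidedHalves

/-! ## §1 Counting distinct large clusters -/

section Counting

variable {ι V : Type*}

/-- **Superadditivity of the cluster trace**: for pairwise disjoint `Λ_i ⊆ Λ'` (`i ∈ J`),
`Σ_{i ∈ J} |K_v ∩ Λ_i| ≤ |K_v ∩ Λ'|`. [folklore] -/
theorem sum_clusterCapIn_le_of_pairwiseDisjoint [DecidableEq V] (Λ' : Finset V) (Λ : ι → Finset V)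
    (J : Finset ι) (hsub : ∀ i ∈ J, Λ i ⊆ Λ') (hdisj : (↑J : Set ι).PairwiseDisjoint Λ)
    (ω : BondConfig V) (v : V) :
    ∑ i ∈ J, clusterCapIn (Λ i) ω v ≤ clusterCapIn Λ' ω v := by
  classical
  have h1 : ∑ i ∈ J, clusterCapIn (Λ i) ω v =
      (J.biUnion fun i => (Λ i).filter fun z => (openGraph ω).Reachable v z).card := by
    rw [Finset.card_biUnion]
    · exact Finset.sum_congr rfl fun i _ => clusterCapIn_eq (Λ i) ω v
    · exact fun i hi j hj hij => Finset.disjoint_filter_filter (hdisj hi hj hij)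
  rw [h1, clusterCapIn_eq]
  refine Finset.card_le_card fun z hz => ?_
  simp only [Finset.mem_biUnion, Finset.mem_filter] at hz ⊢
  obtain ⟨i, hi, hzi, hvz⟩ := hz
  exact ⟨hsub i hi hzi, hvz⟩

/-- **A maximal pairwise non-connected subfamily covers**: every finite set of vertices `W` contains a subset `S`
of pairwise non-connected vertices such that every vertex of `W` is connected to a member of `S` (take `S` of
maximal cardinality among the pairwise non-connected subsets). [folklore] -/
theorem exists_maximal_pairwise_not_reachable (G : SimpleGraph V) (W : Finset V) :
    ∃ S ⊆ W, (↑S : Set V).Pairwise (fun v w => ¬ G.Reachable v w) ∧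
      ∀ w ∈ W, ∃ s ∈ S, G.Reachable s w := by
  classical
  set F : Finset (Finset V) :=
    W.powerset.filter fun S => (↑S : Set V).Pairwise fun v w => ¬ G.Reachable v w with hF
  have hne : F.Nonempty := ⟨∅, by simp [hF]⟩
  obtain ⟨S, hS, hmax⟩ := Finset.exists_max_image F Finset.card hne
  rw [hF, Finset.mem_filter, Finset.mem_powerset] at hS
  refine ⟨S, hS.1, hS.2, fun w hw => ?_⟩
  by_contra h
  push Not at h
  have hwS : w ∉ S := fun hwS => h w hwS (SimpleGraph.Reachable.refl w)
  have hins : insert w S ∈ F := by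
    rw [hF, Finset.mem_filter, Finset.mem_powerset]
    refine ⟨Finset.insert_subset hw hS.1, ?_⟩
    rw [Finset.coe_insert, Set.pairwise_insert]
    exact ⟨hS.2, fun s hs _ => ⟨fun hr => h s hs hr.symm, h s hs⟩⟩
  have := hmax (insert w S) hins
  rw [Finset.card_insert_of_notMem hwS] at this
  omega

/-- `|K_max(∅)| = 0`. [folklore] -/
theorem clusterMaxIn_empty (ω : BondConfig V) : clusterMaxIn (∅ : Finset V) ω = 0 := by
  simp [clusterMaxIn]

/-- **Counting distinct large clusters.** Let `Λ_i ⊆ Λ'` (`i ∈ I`) be pairwise disjoint, `t ≥ 1`, and suppose no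
cluster has `m t` or more vertices in `Λ'`. Call `i` good if some cluster has `≥ t` vertices in `Λ_i`. Then there is
a set `S ⊆ Λ'` of pairwise non-connected vertices, each with `≥ t` cluster vertices in `Λ'`, with `#good ≤ m · #S`
(one cluster serves `< m` good sub-regions, by superadditivity of its trace). [folklore] -/
theorem exists_pairwise_not_reachable_of_clusterMaxIn_lt [DecidableEq V] (Λ' : Finset V) (Λ : ι → Finset V)
    (I : Finset ι) (hsub : ∀ i ∈ I, Λ i ⊆ Λ') (hdisj : (↑I : Set ι).PairwiseDisjoint Λ) (ω : BondConfig V)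
    {t m : ℕ} (ht : 1 ≤ t) (hlt : clusterMaxIn Λ' ω < m * t) :
    ∃ S : Finset V, S ⊆ Λ' ∧ (I.filter fun i => t ≤ clusterMaxIn (Λ i) ω).card ≤ m * S.card ∧
      (∀ v ∈ S, t ≤ clusterCapIn Λ' ω v) ∧ (↑S : Set V).Pairwise fun v w => ¬ (openGraph ω).Reachable v w := by
  classical
  set good := I.filter fun i => t ≤ clusterMaxIn (Λ i) ω with hgood
  set W : Finset V := good.biUnion fun i => (Λ i).filter fun v => t ≤ clusterCapIn (Λ i) ω v with hW
  obtain ⟨S, hSW, hpair, hcov⟩ := exists_maximal_pairwise_not_reachable (openGraph ω) W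
  have hgoodI : good ⊆ I := Finset.filter_subset _ _
  have hmemW : ∀ s ∈ S, ∃ i ∈ good, s ∈ Λ i ∧ t ≤ clusterCapIn (Λ i) ω s := by
    intro s hs
    have := hSW hs
    simp only [hW, Finset.mem_biUnion, Finset.mem_filter] at this
    obtain ⟨i, hi, hsi, hts⟩ := this
    exact ⟨i, hi, hsi, hts⟩
  refine ⟨S, ?_, ?_, ?_, hpair⟩
  · intro s hs
    obtain ⟨i, hi, hsi, -⟩ := hmemW s hs
    exact hsub i (hgoodI hi) hsi
  · -- each `s ∈ S` serves fewer than `m` good sub-regions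
    set served : V → Finset ι := fun s =>
      good.filter fun i => ∃ w ∈ Λ i, t ≤ clusterCapIn (Λ i) ω w ∧ (openGraph ω).Reachable s w with hserved
    have hJ : ∀ s : V, (served s).card ≤ m := by
      intro s
      have h1 : (served s).card * t ≤ ∑ i ∈ served s, clusterCapIn (Λ i) ω s := by
        rw [Finset.card_eq_sum_ones, Finset.sum_mul]
        refine Finset.sum_le_sum fun i hi => ?_
        obtain ⟨-, w, -, htw, hsw⟩ := Finset.mem_filter.1 hi
        rw [one_mul, clusterCapIn_eq_of_reachable (Λ i) hsw]
        exact htw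
      have hservedI : ∀ i ∈ served s, i ∈ I := fun i hi => hgoodI (Finset.mem_filter.1 hi).1
      have h2 := sum_clusterCapIn_le_of_pairwiseDisjoint Λ' Λ (served s) (fun i hi => hsub i (hservedI i hi))
        (hdisj.subset fun i hi => hservedI i hi) ω s
      have h3 := clusterCapIn_le_clusterMaxIn' Λ' ω s
      have h4 : (served s).card * t < m * t := by omega
      have := Nat.lt_of_mul_lt_mul_right h4
      omega
    have hcover : good ⊆ S.biUnion served := by
      intro i hi
      have hi' := (Finset.mem_filter.1 hi).2
      have hne : (Λ i).Nonempty := by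
        by_contra h
        rw [Finset.not_nonempty_iff_eq_empty] at h
        rw [h, clusterMaxIn_empty] at hi'
        omega
      obtain ⟨w, hw, heq⟩ := exists_clusterCapIn_eq_clusterMaxIn hne ω
      have htw : t ≤ clusterCapIn (Λ i) ω w := heq ▸ hi'
      obtain ⟨s, hs, hsw⟩ := hcov w (Finset.mem_biUnion.2 ⟨i, hi, Finset.mem_filter.2 ⟨hw, htw⟩⟩)
      exact Finset.mem_biUnion.2 ⟨s, hs, Finset.mem_filter.2 ⟨hi, w, hw, htw, hsw⟩⟩
    calc good.card ≤ (S.biUnion served).card := Finset.card_le_card hcover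
      _ ≤ ∑ s ∈ S, (served s).card := Finset.card_biUnion_le
      _ ≤ ∑ _s ∈ S, m := Finset.sum_le_sum fun s _ => hJ s
      _ = m * S.card := by rw [Finset.sum_const, smul_eq_mul, mul_comm]
  · intro s hs
    obtain ⟨i, hi, hsi, hts⟩ := hmemW s hs
    exact hts.trans (clusterCapIn_mono_set (hsub i (hgoodI hi)) ω s)

end Counting

/-! ## §2 Lateral translates of the half-boxes -/

/-- **A lateral translate of `Λ_r` inside `Λ_R`**: for `z₀ = 0`, `|z₁|, |z₂| ≤ c` and `r + c ≤ R`, `Λ_r + z ⊆ Λ_R`.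
[folklore] -/
theorem halfBox_translate_subset_halfBox {r c R : ℕ} {z : V3} (hz0 : z 0 = 0) (hz1 : |z 1| ≤ c)
    (hz2 : |z 2| ≤ c) (hR : r + c ≤ R) : (halfBox r).image (· + z) ⊆ halfBox R := by
  intro y hy
  rw [Finset.mem_image] at hy
  obtain ⟨x, hx, rfl⟩ := hy
  rw [halfBox, Finset.mem_filter, mem_box, forall_fin3] at hx ⊢
  simp only [Pi.add_apply, hz0, add_zero]
  rw [abs_le] at hz1 hz2
  have hR' : (r : ℤ) + c ≤ R := by exact_mod_cast hR
  omega

/-- **Far-apart lateral translates are disjoint**: if `|z₁ - z'₁| ≥ 2r+1` or `|z₂ - z'₂| ≥ 2r+1` then `Λ_r + z` and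
`Λ_r + z'` are disjoint. [folklore] -/
theorem disjoint_halfBox_translate {r : ℕ} {z z' : V3}
    (h : (2 * r + 1 : ℤ) ≤ |z 1 - z' 1| ∨ (2 * r + 1 : ℤ) ≤ |z 2 - z' 2|) :
    Disjoint ((halfBox r).image (· + z)) ((halfBox r).image (· + z')) := by
  rw [Finset.disjoint_left]
  intro y hy hy'
  rw [Finset.mem_image] at hy hy'
  obtain ⟨x, hx, rfl⟩ := hy
  obtain ⟨x', hx', hxx'⟩ := hy'
  rw [halfBox, Finset.mem_filter, mem_box, forall_fin3] at hx hx'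
  have h1 := congr_fun hxx' 1
  have h2 := congr_fun hxx' 2
  simp only [Pi.add_apply] at h1 h2
  rcases h with h | h <;> rw [le_abs] at h <;> omega

/-- The translates `Λ_r + z_a`, `z_a = (0, (2r+1)(a₁ - A), (2r+1)(a₂ - A))`, `a ∈ {0,…,2A}²`, lie in `Λ_{(3A+1) r}`
(`r ≥ 1`). [folklore] -/
theorem halfBox_latTranslate_subset {r : ℕ} (hr : 1 ≤ r) (A : ℕ) {a : ℕ × ℕ}
    (ha : a ∈ Finset.range (2 * A + 1) ×ˢ Finset.range (2 * A + 1)) :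
    (halfBox r).image (· + (![0, ((2 * r + 1 : ℕ) : ℤ) * ((a.1 : ℤ) - A),
        ((2 * r + 1 : ℕ) : ℤ) * ((a.2 : ℤ) - A)] : V3)) ⊆ halfBox ((3 * A + 1) * r) := by
  rw [Finset.mem_product, Finset.mem_range, Finset.mem_range] at ha
  have hb : ∀ b : ℕ, b < 2 * A + 1 → |((2 * r + 1 : ℕ) : ℤ) * ((b : ℤ) - A)| ≤ ((3 * A * r : ℕ) : ℤ) := by
    intro b hb
    rw [abs_mul]
    have h1 : |((b : ℤ) - A)| ≤ A := by rw [abs_le]; omega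
    have h2 : |((2 * r + 1 : ℕ) : ℤ)| ≤ 3 * r := by
      rw [abs_of_nonneg (by positivity)]; push_cast; omega
    calc |((2 * r + 1 : ℕ) : ℤ)| * |((b : ℤ) - A)| ≤ (3 * r) * A :=
          mul_le_mul h2 h1 (abs_nonneg _) (by positivity)
      _ = ((3 * A * r : ℕ) : ℤ) := by push_cast; ring
  refine halfBox_translate_subset_halfBox (c := 3 * A * r) (by simp) ?_ ?_ (le_of_eq (by ring))
  · simpa using hb a.1 ha.1
  · simpa using hb a.2 ha.2

/-- The translates `Λ_r + z_a`, `a ∈ ℕ²`, are pairwise disjoint. [folklore] -/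
theorem pairwiseDisjoint_halfBox_latTranslate (r : ℕ) (A : ℕ) :
    (Set.univ : Set (ℕ × ℕ)).PairwiseDisjoint fun a =>
      (halfBox r).image (· + (![0, ((2 * r + 1 : ℕ) : ℤ) * ((a.1 : ℤ) - A),
        ((2 * r + 1 : ℕ) : ℤ) * ((a.2 : ℤ) - A)] : V3)) := by
  intro a _ a' _ hne
  refine disjoint_halfBox_translate ?_
  simp only [Matrix.cons_val_one, Matrix.head_cons, Matrix.cons_val_two, Matrix.tail_cons]
  have key : ∀ b b' : ℕ, b ≠ b' →
      (2 * r + 1 : ℤ) ≤ |((2 * r + 1 : ℕ) : ℤ) * ((b : ℤ) - A) - ((2 * r + 1 : ℕ) : ℤ) * ((b' : ℤ) - A)| := by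
    intro b b' hbb'
    rw [← mul_sub, abs_mul, abs_of_nonneg (show (0 : ℤ) ≤ ((2 * r + 1 : ℕ) : ℤ) by positivity)]
    have h1 : (1 : ℤ) ≤ |((b : ℤ) - A) - ((b' : ℤ) - A)| := by
      apply Int.one_le_abs; omega
    calc (2 * r + 1 : ℤ) = ((2 * r + 1 : ℕ) : ℤ) * 1 := by push_cast; ring
      _ ≤ ((2 * r + 1 : ℕ) : ℤ) * |((b : ℤ) - A) - ((b' : ℤ) - A)| :=
          mul_le_mul_of_nonneg_left h1 (by positivity)
  by_cases h1 : a.1 = a'.1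
  · exact Or.inr (key a.2 a'.2 fun h2 => hne (Prod.ext h1 h2))
  · exact Or.inl (key a.1 a'.1 h1)

/-! ## §3 Markov's inequality for the number of bad translates -/

open scoped Classical in
/-- **Half of the events fail with probability at most `2δ`**: if each of the finitely many measurable events `E_i`
(`i ∈ s ≠ ∅`) has probability `≤ δ`, then `P(#{i ∈ s : E_i} ≥ #s / 2) ≤ 2δ` (Markov's inequality for the count,
`Literature.Barriers.CriticalPhenomena.mul_real_card_filter_ge_le_sum`). [folklore] -/
theorem real_half_le_card_filter_le {Ω ι : Type*} [MeasurableSpace Ω] (μ : Measure Ω) [IsFiniteMeasure μ]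
    (s : Finset ι) (hs : s.Nonempty) {E : ι → Set Ω} (hE : ∀ i ∈ s, MeasurableSet (E i)) {δ : ℝ}
    (hδ : ∀ i ∈ s, μ.real (E i) ≤ δ) :
    μ.real {ω | (s.card : ℝ) / 2 ≤ ((s.filter fun i => ω ∈ E i).card : ℝ)} ≤ 2 * δ := by
  have h := Literature.Barriers.CriticalPhenomena.mul_real_card_filter_ge_le_sum μ s hE ((s.card : ℝ) / 2)
  have hsum : ∑ i ∈ s, μ.real (E i) ≤ s.card * δ := by
    calc ∑ i ∈ s, μ.real (E i) ≤ ∑ _i ∈ s, δ := Finset.sum_le_sum hδ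
      _ = s.card * δ := by rw [Finset.sum_const, nsmul_eq_mul]
  have hc : (0 : ℝ) < s.card := by exact_mod_cast hs.card_pos
  by_contra hlt
  push Not at hlt
  have := mul_lt_mul_of_pos_left hlt (by positivity : (0 : ℝ) < s.card / 2)
  linarith

/-! ## §4 The transfer: cluster-count tightness ⟹ G -/

open scoped Classical in
/-- **G ⟸ tightness of the number of macroscopic clusters** (registered helper; the Borgs–Chayes–Kesten–Spencer
1999 cluster-count postulate, transferred to the induced half-space percolation at `p_c(ℤ³)`). If for SOME `K` and
every `R ≥ 1`, with `P^ℍ_{p_c}`-probability at most `1/4` the half-box `Λ_R` contains `K` pairwise non-connected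
vertices whose clusters each have `≥ M(Λ_R)/128` vertices in `Λ_R`, then stub G of line `onesided-halves` holds:
`∃ c κ > 0, ∀ 1 ≤ ρ ≤ r, c (r/ρ)^κ M(Λ_ρ) ≤ M(Λ_r)`. Proof in the module docstring (fixed-ratio doubling at
`L = 3(20K+1)+1` by the dichotomy "merge or many distinct near-maximal clusters"). [folklore] -/
theorem typicalMaxPolyGrowth_of_tightClusterCount :
    (∃ K : ℕ, ∀ R : ℕ, 1 ≤ R →
      (floorDilutedPercolation 3 (criticalProbI 3) 1).real
        {ω | ∃ S : Finset V3, S ⊆ halfBox R ∧ K ≤ S.card ∧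
            (∀ v ∈ S, (typicalMax (floorDilutedPercolation 3 (criticalProbI 3) 1) (halfBox R) : ℝ) / 128 ≤
              (clusterCapIn (halfBox R) ω v : ℝ)) ∧
            (↑S : Set V3).Pairwise fun v w => ¬ (openGraph ω).Reachable v w} ≤ 1 / 4) →
    ∃ c κ : ℝ, 0 < c ∧ 0 < κ ∧ ∀ ρ r : ℕ, 1 ≤ ρ → ρ ≤ r →
      c * ((r : ℝ) / ρ) ^ κ * (typicalMax (floorDilutedPercolation 3 (criticalProbI 3) 1) (halfBox ρ) : ℝ) ≤
        typicalMax (floorDilutedPercolation 3 (criticalProbI 3) 1) (halfBox r) := by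
  rintro ⟨K, hK⟩
  rw [typicalMaxPolyGrowth_iff_fixedRatio]
  refine ⟨3 * (20 * K + 1) + 1, by omega, fun r hr => ?_⟩
  by_contra hlt
  push Not at hlt
  set A : ℕ := 20 * K + 1 with hA
  set P := floorDilutedPercolation 3 (criticalProbI 3) 1 with hP
  have hLr : 1 ≤ (3 * A + 1) * r := le_trans hr (Nat.le_mul_of_pos_left r (by omega))
  have hEv := hK ((3 * A + 1) * r) hLr
  set M := typicalMax P (halfBox r) with hM
  set M' := typicalMax P (halfBox ((3 * A + 1) * r)) with hM'
  set Λ' := halfBox ((3 * A + 1) * r) with hΛ'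
  -- the lateral translates `Λ_r + z_a` (`a ∈ I = {0,…,2A}²`), the threshold `t = ⌈M/64⌉`, the bad events `E_a`
  -- (kept opaque, so that the decidability instances of the filters below stay classical), `B` and `U`
  set z : ℕ × ℕ → V3 := fun a =>
    ![0, ((2 * r + 1 : ℕ) : ℤ) * ((a.1 : ℤ) - A), ((2 * r + 1 : ℕ) : ℤ) * ((a.2 : ℤ) - A)] with hz
  set Λt : ℕ × ℕ → Finset V3 := fun a => (halfBox r).image (· + z a) with hΛt
  set I : Finset (ℕ × ℕ) := Finset.range (2 * A + 1) ×ˢ Finset.range (2 * A + 1) with hI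
  set t : ℕ := ⌈(M : ℝ) / 64⌉₊ with ht
  obtain ⟨E, hE⟩ : ∃ E : ℕ × ℕ → Set (BondConfig V3), E = fun a => {ω | ¬ t ≤ clusterMaxIn (Λt a) ω} :=
    ⟨_, rfl⟩
  set B : Set (BondConfig V3) := {ω | (I.card : ℝ) / 2 ≤ ((I.filter fun a => ω ∈ E a).card : ℝ)} with hB
  set U : Set (BondConfig V3) := {ω | (2 * 1 + 1) * M' ≤ clusterMaxIn Λ' ω} with hU
  -- numerics
  have hM2 : 2 ≤ M := two_le_typicalMax P (halfBox_nonempty r)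
  have hMpos : (0 : ℝ) < M := by exact_mod_cast (show 0 < M by omega)
  have ht1 : 1 ≤ t := Nat.ceil_pos.2 (div_pos hMpos (by norm_num))
  have hMt : (M : ℝ) / 64 ≤ t := Nat.le_ceil _
  have hMt' : M ≤ 64 * t := by
    have : (M : ℝ) ≤ 64 * t := by linarith
    exact_mod_cast this
  have hIcard : I.card = (2 * A + 1) ^ 2 := by rw [hI, Finset.card_product, Finset.card_range, sq]
  have hIne : I.Nonempty := ⟨(0, 0), by simp [hI]⟩
  -- (1) geometry of the translates
  have hsub : ∀ a ∈ I, Λt a ⊆ Λ' := fun a ha => halfBox_latTranslate_subset hr A ha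
  have hdisj : (↑I : Set (ℕ × ℕ)).PairwiseDisjoint Λt :=
    (pairwiseDisjoint_halfBox_latTranslate r A).subset (Set.subset_univ _)
  -- (2) each translate is bad with probability ≤ 1/8; at least half of them are bad with probability ≤ 1/4
  have hEmeas : ∀ a ∈ I, MeasurableSet (E a) := fun a _ => by
    rw [hE]
    exact (measurableSet_clusterMaxIn_ge (Λt a) t).compl
  have hEδ : ∀ a ∈ I, P.real (E a) ≤ 1 / 8 := by
    intro a _
    have hz0 : z a 0 = 0 := by simp [hz]
    have hsubset : E a ⊆ {ω | (clusterMaxIn ((halfBox r).image (· + z a)) ω : ℝ) < (1 / 64) * M} := by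
      intro ω hω
      rw [hE] at hω
      have := Nat.lt_ceil.1 (not_le.1 hω)
      simp only [Set.mem_setOf_eq]
      linarith
    calc P.real (E a) ≤ P.real {ω | (clusterMaxIn ((halfBox r).image (· + z a)) ω : ℝ) < (1 / 64) * M} :=
          measureReal_mono hsubset (measure_ne_top _ _)
      _ ≤ 8 * (1 / 64) := real_clusterMaxIn_halfBox_translate_lt_le hz0 r (by norm_num)
      _ = 1 / 8 := by norm_num
  have hBad : P.real B ≤ 2 * (1 / 8) := real_half_le_card_filter_le P I hIne hEmeas hEδ
  -- (3) the upper tail at scale `Lr`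
  have hUp : P.real U ≤ Real.exp (-2) := by
    have h : P.real U ≤ Real.exp (-((1 : ℕ) + 1 : ℝ)) :=
      prodBernoulli_real_mul_typicalMax_le_clusterMaxIn_le (floorDilutedParam 3 (criticalProbI 3) 1)
        (halfBox_nonempty _) 1
    have h2 : Real.exp (-((1 : ℕ) + 1 : ℝ)) = Real.exp (-2) := by norm_num
    rwa [h2] at h
  have hexp : Real.exp (-2) < 1 / 2 := by
    have h1 : Real.exp (-2) ≤ Real.exp (-1) := Real.exp_le_exp.2 (by norm_num)
    have h2 := Real.exp_neg_one_lt_d9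
    have h3 : (0.3678794412 : ℝ) < 1 / 2 := by norm_num
    linarith
  -- (4) counting: off `B ∪ U` the hypothesis' event at `R = Lr` occurs
  have hincl : Bᶜ ∩ Uᶜ ⊆
      {ω | ∃ S : Finset V3, S ⊆ Λ' ∧ K ≤ S.card ∧ (∀ v ∈ S, (M' : ℝ) / 128 ≤ (clusterCapIn Λ' ω v : ℝ)) ∧
        (↑S : Set V3).Pairwise fun v w => ¬ (openGraph ω).Reachable v w} := by
    rintro ω ⟨hωB, hωU⟩
    have hωB' : ((I.filter fun a => ω ∈ E a).card : ℝ) < (I.card : ℝ) / 2 := not_le.1 hωB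
    have hωU' : clusterMaxIn Λ' ω < (2 * 1 + 1) * M' := not_le.1 hωU
    have hlt' : clusterMaxIn Λ' ω < 384 * t := by omega
    obtain ⟨S, hSsub, hcard, hthr, hpair⟩ :=
      exists_pairwise_not_reachable_of_clusterMaxIn_lt Λ' Λt I hsub hdisj ω ht1 hlt'
    refine ⟨S, hSsub, ?_, ?_, hpair⟩
    · have hsplit := Finset.card_filter_add_card_filter_not (s := I) (fun a => t ≤ clusterMaxIn (Λt a) ω)
      have hbadeq : (I.filter fun a => ω ∈ E a) = I.filter fun a => ¬ t ≤ clusterMaxIn (Λt a) ω :=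
        Finset.filter_congr fun a _ => by rw [hE]; exact Iff.rfl
      rw [hbadeq] at hωB'
      have h2 : 2 * (I.filter fun a => ¬ t ≤ clusterMaxIn (Λt a) ω).card < I.card := by
        have : (2 : ℝ) * ((I.filter fun a => ¬ t ≤ clusterMaxIn (Λt a) ω).card : ℝ) < I.card := by
          linarith
        exact_mod_cast this
      rw [hIcard] at h2 hsplit
      have hKK : K ≤ K * K := Nat.le_mul_self K
      have hT : (2 * A + 1) ^ 2 = 1600 * (K * K) + 240 * K + 9 := by rw [hA]; ring
      rw [hT] at h2 hsplit
      omega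
    · intro v hv
      have h1 : (t : ℝ) ≤ clusterCapIn Λ' ω v := by exact_mod_cast hthr v hv
      have h2 : (M' : ℝ) + 1 ≤ 2 * M := by exact_mod_cast hlt
      linarith
  -- (5) the contradiction: `1 ≤ P(Bᶜ ∩ Uᶜ) + P(B) + P(U) ≤ 1/4 + 1/4 + e^{-2} < 1`
  have huniv : (Set.univ : Set (BondConfig V3)) ⊆ (Bᶜ ∩ Uᶜ ∪ B) ∪ U := by
    intro ω _
    by_cases h1 : ω ∈ B
    · exact Or.inl (Or.inr h1)
    · by_cases h2 : ω ∈ U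
      · exact Or.inr h2
      · exact Or.inl (Or.inl ⟨h1, h2⟩)
  have hchain : (1 : ℝ) ≤ P.real (Bᶜ ∩ Uᶜ) + P.real B + P.real U :=
    calc (1 : ℝ) = P.real Set.univ := probReal_univ.symm
      _ ≤ P.real ((Bᶜ ∩ Uᶜ ∪ B) ∪ U) := measureReal_mono huniv (measure_ne_top _ _)
      _ ≤ P.real (Bᶜ ∩ Uᶜ ∪ B) + P.real U := measureReal_union_le _ _
      _ ≤ P.real (Bᶜ ∩ Uᶜ) + P.real B + P.real U := by
          have := measureReal_union_le (μ := P) (Bᶜ ∩ Uᶜ) B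
          linarith
  have hD : P.real (Bᶜ ∩ Uᶜ) ≤ 1 / 4 := le_trans (measureReal_mono hincl (measure_ne_top _ _)) hEv
  linarith

end Summit.CriticalPhenomena.PercolationContinuityZ3.Theorems.TallClusterMassBound.OnesidedHalves

end
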